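import Summits.HodgeConjecture.CorCM.SexticOcticSlotTrace
import HarnessLib

/-!
# A sextic slot against an octic slot, V: a three-dimensional common constituent — the orbit vector, its image,
# and the pair differences it drags along

COR-CM (cell `pub-hodgecm2`, binder seat `b16` gen 47, count-neutral claim CM34-COMPLETE, file F5; theorems only, no
definition, no named fact, no `sorry`).  Setting of F1–F4 (frames `e : Fin 6 → X`, `e' : Fin 8 → Y` of an element `c`
of order three; a common constituent `(P, T)`; `G` transitive on `Y`), now with `dim P = 3`, i.e. `P` = ALL odd
weights on `X` (`eq_antiWeights_of_finrank_eq_three`).  The ORBIT VECTOR `a` is the odd weight with values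
`(1, 1, 1, −1, −1, −1)` on the frame — the type vector `2·𝟙_{Φ₊} − 1` of the orbit type `Φ₊ = {x₀, cx₀, c²x₀}`; it is
`c`-invariant with trace `3`, and `t = Ta` is `c`-invariant: `t = (α, −α, β, β, β, −β, −β, −β)` on `e'`
(`apply_map_orbitVec_frame`).  Writing `s`, `a(·) = ·(y₀)`, `S` for the traces of F4:

* **`trace_identity`** — for every odd `f`: `3·(Tf)(y₀) = s(f)·α` and `3·S(Tf) = s(f)·S(t)` (decompose
  `f = (s(f)/3)·a + f₀` with `f₀` traceless and use F4 §1);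
* **`apply_map_orbitVec_ne_zero`** (`α ≠ 0`: else `(Tf)(y₀) = 0` for all `f`, against F4's translate) and
  **`sum_map_orbitVec_ne_zero`** (`β ≠ 0`: else `S ∘ T = 0`, but for `g y₁ = y₀` the translate `t∘g = T(a∘g)` has
  `S = α`);
* **`single_sub_single_sub_mem_map`** — the difference `v₀ − v₁` of the pair vectors of `y₁` and `cy₁` lies in `T(P)`:
  explicitly `D·(v₀ − v₁) = −b₀·q + b₂·(q∘c)` for a traceless `q = Tp` with values `(0; b₀, b₁, b₂)`,
  `D = −(b₀² + b₀b₂ + b₂²) ≠ 0`.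

These feed the stabiliser computation of `SexticOcticSlotReflexStabilizer`.

## References

* [Dodson1984] B. Dodson, *The structure of Galois groups of CM-fields*, Trans. AMS 283 (1984), §5.1.1–§5.1.2, §3.3.
* [Serre1977] J.-P. Serre, *Linear Representations of Finite Groups*, GTM 42, §2.6.
-/

noncomputable section

namespace Summit.HodgeConjecture.CorCM.SexticOctic

open Literature.NumberTheory.ComplexMultiplication

variable {G : Type*} [Group G] {X Y : Type*} [MulAction G X] [MulAction G Y] {ρ : G}

/-! ## §1 The orbit vector -/

/-- **The orbit vector is odd.** [cite: Dodson1984, §5.1.2] -/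
theorem orbitVec_mem_antiWeights {e : Fin 6 → X} (hsurj : Function.Surjective e)
    (hρe : ∀ i, ρ • e i = e (![3, 4, 5, 0, 1, 2] i)) {a : X → ℚ} (ha : ∀ i, a (e i) = ![1, 1, 1, -1, -1, -1] i) :
    a ∈ antiWeights (E := X) ρ := by
  rw [mem_antiWeights_iff']
  intro x
  obtain ⟨i, rfl⟩ := hsurj x
  rw [hρe, ha, ha]
  fin_cases i <;> simp

/-- **The orbit vector is `c`-invariant** (`c` permutes `x₀, cx₀, c²x₀`). [cite: Dodson1984, §5.1.2] -/
theorem orbitVec_comp_eq {e : Fin 6 → X} (hsurj : Function.Surjective e) {c : G}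
    (hce : ∀ i, c • e i = e (![1, 2, 0, 4, 5, 3] i)) {a : X → ℚ} (ha : ∀ i, a (e i) = ![1, 1, 1, -1, -1, -1] i) :
    (fun x => a (c • x)) = a := by
  refine eq_of_forall_frame hsurj fun i => ?_
  rw [hce, ha, ha]
  fin_cases i <;> simp

/-- **The odd weights on `X` have dimension `≤ 3`** (they embed in `ℚ³` by the values at `x₀, cx₀, c²x₀`). [folklore] -/
theorem finrank_antiWeights_le_three {e : Fin 6 → X} (hsurj : Function.Surjective e)
    (hρe : ∀ i, ρ • e i = e (![3, 4, 5, 0, 1, 2] i)) : Module.finrank ℚ (antiWeights (E := X) ρ) ≤ 3 := by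
  let L : (X → ℚ) →ₗ[ℚ] (Fin 3 → ℚ) :=
    LinearMap.pi fun j : Fin 3 => LinearMap.proj (R := ℚ) (φ := fun _ : X => ℚ) (e (![0, 1, 2] j))
  have hL : ∀ (f : X → ℚ) (j : Fin 3), L f j = f (e (![0, 1, 2] j)) := fun f j => rfl
  have hinj : Function.Injective (L.domRestrict (antiWeights (E := X) ρ)) := by
    rw [← LinearMap.ker_eq_bot, LinearMap.ker_eq_bot']
    rintro ⟨f, hf⟩ h0
    have h := fun j => congrFun (congrArg Subtype.val (show (⟨L f, trivial⟩ : {x : Fin 3 → ℚ // True}) =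
      ⟨0, trivial⟩ from by simpa using h0)) j
    apply Subtype.ext
    exact eq_zero_of_frame₆ hsurj hρe hf (by simpa [hL] using h 0) (by simpa [hL] using h 1)
      (by simpa [hL] using h 2)
  have := LinearMap.finrank_le_finrank_of_injective hinj
  simpa using this

/-- **A three-dimensional common constituent is all of the odd weights on `X`.** [folklore] -/
theorem eq_antiWeights_of_finrank_eq_three {e : Fin 6 → X} (hsurj : Function.Surjective e)
    (hρe : ∀ i, ρ • e i = e (![3, 4, 5, 0, 1, 2] i)) {P : Submodule ℚ (X → ℚ)}
    (hPanti : P ≤ antiWeights (E := X) ρ) (h3 : Module.finrank ℚ P = 3) : P = antiWeights (E := X) ρ := by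
  haveI : Finite X := Finite.of_surjective e hsurj
  exact Submodule.eq_of_le_of_finrank_le hPanti (by rw [h3]; exact finrank_antiWeights_le_three hsurj hρe)

/-! ## §2 The image `t = Ta` of the orbit vector and the trace identity -/

section Constituent

variable {e : Fin 6 → X} {c : G} {e' : Fin 8 → Y} {P : Submodule ℚ (X → ℚ)} {T : (X → ℚ) →ₗ[ℚ] (Y → ℚ)}
  {a : X → ℚ}

/-- **`t = Ta` on the frame: `(α, −α, β, β, β, −β, −β, −β)`** — `t` is odd and `c`-invariant (`t∘c = T(a∘c) = Ta`).
[cite: Dodson1984, §5.1.1] -/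
theorem apply_map_orbitVec_frame (hsurj : Function.Surjective e) {c : G}
    (hce : ∀ i, c • e i = e (![1, 2, 0, 4, 5, 3] i))
    (hρe' : ∀ i, ρ • e' i = e' (![1, 0, 5, 6, 7, 2, 3, 4] i)) (hce' : ∀ i, c • e' i = e' (![0, 1, 3, 4, 2, 6, 7, 5] i))
    (hT : ∀ g : G, ∀ f ∈ P, T (fun x => f (g • x)) = fun y => T f (g • y))
    (hTanti : ∀ f ∈ P, T f ∈ antiWeights (E := Y) ρ) (ha : ∀ i, a (e i) = ![1, 1, 1, -1, -1, -1] i)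
    (haP : a ∈ P) (i : Fin 8) :
    T a (e' i) = ![T a (e' 0), -T a (e' 0), T a (e' 2), T a (e' 2), T a (e' 2), -T a (e' 2), -T a (e' 2),
      -T a (e' 2)] i := by
  have hfix : ∀ y, T a (c • y) = T a y := fun y => by
    have h := hT c a haP
    rw [orbitVec_comp_eq hsurj hce ha] at h
    exact (congrFun h y).symm
  have h3 : T a (e' 3) = T a (e' 2) := by have := hfix (e' 2); rw [hce'] at this; exact this
  have h4 : T a (e' 4) = T a (e' 2) := by have := hfix (e' 3); rw [hce'] at this; exact this.trans h3
  rw [apply_frame₈ hρe' (hTanti a haP) i]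
  fin_cases i <;> simp [h3, h4]

/-- **The trace identity.**  For every `f ∈ P` (all odd weights): `3·(Tf)(y₀) = s(f)·t(y₀)` and
`3·S(Tf) = s(f)·S(t)`, where `t = Ta` (decompose `f = (s(f)/3)·a + f₀`, `f₀` traceless). [cite: Serre1977, §2.6] -/
theorem trace_identity (hsurj : Function.Surjective e) (hρe : ∀ i, ρ • e i = e (![3, 4, 5, 0, 1, 2] i))
    (hce : ∀ i, c • e i = e (![1, 2, 0, 4, 5, 3] i)) (hce' : ∀ i, c • e' i = e' (![0, 1, 3, 4, 2, 6, 7, 5] i))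
    (hPanti : P ≤ antiWeights (E := X) ρ) (hPst : ∀ g : G, ∀ f ∈ P, (fun x => f (g • x)) ∈ P)
    (hT : ∀ g : G, ∀ f ∈ P, T (fun x => f (g • x)) = fun y => T f (g • y))
    (ha : ∀ i, a (e i) = ![1, 1, 1, -1, -1, -1] i) (haP : a ∈ P) {f : X → ℚ} (hf : f ∈ P) :
    3 * T f (e' 0) = (f (e 0) + f (e 1) + f (e 2)) * T a (e' 0) ∧
      3 * (T f (e' 2) + T f (e' 3) + T f (e' 4)) =
        (f (e 0) + f (e 1) + f (e 2)) * (T a (e' 2) + T a (e' 3) + T a (e' 4)) := by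
  set σ := f (e 0) + f (e 1) + f (e 2) with hσ
  have hf₀ : f - (σ / 3) • a ∈ P := P.sub_mem hf (P.smul_mem _ haP)
  have htr : (f - (σ / 3) • a) (e 0) + (f - (σ / 3) • a) (e 1) + (f - (σ / 3) • a) (e 2) = 0 := by
    simp only [Pi.sub_apply, Pi.smul_apply, smul_eq_mul, ha]
    simp
    ring
  obtain ⟨h0, hS⟩ := apply_eq_zero_and_sum_eq_zero_of_trace hsurj hρe hce hce' hPanti hPst T hT hf₀ htr
  simp only [map_sub, map_smul, Pi.sub_apply, Pi.smul_apply, smul_eq_mul] at h0 hS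
  constructor
  · linear_combination 3 * h0
  · linear_combination 3 * hS

/-- **`α = t(y₀) ≠ 0`**: otherwise `(Tf)(y₀) = 0` for every `f ∈ P`, but some translate `T(a∘g)` does not vanish at
`y₀` (F4). [cite: Serre1977, §2.6] -/
theorem apply_map_orbitVec_ne_zero [MulAction.IsPretransitive G Y] (hsurj : Function.Surjective e)
    (hρe : ∀ i, ρ • e i = e (![3, 4, 5, 0, 1, 2] i)) (hce : ∀ i, c • e i = e (![1, 2, 0, 4, 5, 3] i))
    (hsurj' : Function.Surjective e') (hce' : ∀ i, c • e' i = e' (![0, 1, 3, 4, 2, 6, 7, 5] i))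
    (hPanti : P ≤ antiWeights (E := X) ρ) (hPst : ∀ g : G, ∀ f ∈ P, (fun x => f (g • x)) ∈ P)
    (hT : ∀ g : G, ∀ f ∈ P, T (fun x => f (g • x)) = fun y => T f (g • y))
    (hTinj : ∀ f ∈ P, T f = 0 → f = 0) (ha : ∀ i, a (e i) = ![1, 1, 1, -1, -1, -1] i) (haP : a ∈ P) :
    T a (e' 0) ≠ 0 := by
  intro hα
  have ha0 : a ≠ 0 := fun h => by have := congrFun h (e 0); rw [ha] at this; simp at this
  obtain ⟨g, hg⟩ := exists_apply_translate_ne_zero hsurj' T hT hTinj haP ha0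
  have h := (trace_identity hsurj hρe hce hce' hPanti hPst hT ha haP (hPst g a haP)).1
  rw [hα, mul_zero] at h
  exact hg (by linarith)

/-- **`S(t) ≠ 0`** (`β ≠ 0`): otherwise `S(Tf) = 0` for every `f ∈ P`; but for `g ∈ G` with `g y₁ = y₀` the translate
`t∘g = T(a∘g)` has `S(t∘g) = t(y₀) + t(g cy₁) + t(g c²y₁) = α ≠ 0` (the last two points lie off the fixed pair, where
`t = ±β = 0`). [cite: Dodson1984, §5.1.1] -/
theorem sum_map_orbitVec_ne_zero [MulAction.IsPretransitive G Y] (hsurj : Function.Surjective e)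
    (hρe : ∀ i, ρ • e i = e (![3, 4, 5, 0, 1, 2] i)) (hce : ∀ i, c • e i = e (![1, 2, 0, 4, 5, 3] i))
    (he' : Function.Injective e') (hsurj' : Function.Surjective e')
    (hρe' : ∀ i, ρ • e' i = e' (![1, 0, 5, 6, 7, 2, 3, 4] i)) (hce' : ∀ i, c • e' i = e' (![0, 1, 3, 4, 2, 6, 7, 5] i))
    (hcomm : ∀ (g : G) (y : Y), g • ρ • y = ρ • g • y)
    (hPanti : P ≤ antiWeights (E := X) ρ) (hPst : ∀ g : G, ∀ f ∈ P, (fun x => f (g • x)) ∈ P)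
    (hT : ∀ g : G, ∀ f ∈ P, T (fun x => f (g • x)) = fun y => T f (g • y))
    (hTanti : ∀ f ∈ P, T f ∈ antiWeights (E := Y) ρ) (hTinj : ∀ f ∈ P, T f = 0 → f = 0)
    (ha : ∀ i, a (e i) = ![1, 1, 1, -1, -1, -1] i) (haP : a ∈ P) :
    T a (e' 2) + T a (e' 3) + T a (e' 4) ≠ 0 := by
  intro hβ
  have hα := apply_map_orbitVec_ne_zero hsurj hρe hce hsurj' hce' hPanti hPst hT hTinj ha haP
  have hval := apply_map_orbitVec_frame hsurj hce hρe' hce' hT hTanti ha haP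
  have hβ0 : T a (e' 2) = 0 := by
    have h3 := hval 3; have h4 := hval 4
    simp at h3 h4
    linarith
  obtain ⟨g, hg⟩ := MulAction.exists_smul_eq G (e' 2) (e' 0)
  obtain ⟨π, hπ, hπinj, hπr⟩ := exists_indexMap he' hsurj' hρe' hcomm g
  have hπ2 : π 2 = 0 := he' (by rw [← hπ 2, hg])
  have hπ5 : π 5 = 1 := by have := hπr 2; simp only [Matrix.cons_val] at this; rw [this, hπ2]; rfl
  have hπ3 : π 3 ≠ 0 := fun h => absurd (hπinj (h.trans hπ2.symm)) (by decide)
  have hπ3' : π 3 ≠ 1 := fun h => absurd (hπinj (h.trans hπ5.symm)) (by decide)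
  have hπ4 : π 4 ≠ 0 := fun h => absurd (hπinj (h.trans hπ2.symm)) (by decide)
  have hπ4' : π 4 ≠ 1 := fun h => absurd (hπinj (h.trans hπ5.symm)) (by decide)
  -- the values of `t` off the fixed pair vanish (`β = 0`)
  have hval' : ∀ i, T a (e' i) = ![T a (e' 0), -T a (e' 0), 0, 0, 0, 0, 0, 0] i := by
    intro i
    have h := hval i
    fin_cases i <;> simp [hβ0] at h ⊢ <;> linarith
  have hv3 : T a (e' (π 3)) = 0 := by
    rw [hval' (π 3)]
    generalize π 3 = k at hπ3 hπ3' ⊢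
    fin_cases k <;> simp at hπ3 hπ3' ⊢
  have hv4 : T a (e' (π 4)) = 0 := by
    rw [hval' (π 4)]
    generalize π 4 = k at hπ4 hπ4' ⊢
    fin_cases k <;> simp at hπ4 hπ4' ⊢
  -- `S(T(a∘g)) = 0` by the trace identity, but it equals `α`
  have hS := (trace_identity hsurj hρe hce hce' hPanti hPst hT ha haP (hPst g a haP)).2
  rw [hβ, mul_zero, hT g a haP] at hS
  simp only at hS
  rw [hπ, hπ, hπ, hπ2, hv3, hv4] at hS
  exact hα (by linarith)

/-! ## §3 The pair differences on `Y` lie in the image -/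

/-- **`v₀ − v₁ ∈ T(P)`**: the difference of the pair vectors `δ_{y₁} − δ_{ρy₁}` and `δ_{cy₁} − δ_{ρcy₁}` is the
combination `D⁻¹(−b₀·q + b₂·(q∘c))` of a traceless `q = Tp` with frame values `(0; b₀, b₁, b₂)` and its `c`-translate,
`D = −(b₀² + b₀b₂ + b₂²) ≠ 0`. [cite: Serre1977, §2.6] [cite: Dodson1984, §5.1.1] -/
theorem single_sub_single_sub_mem_map [DecidableEq Y] (hsurj : Function.Surjective e)
    (hρe : ∀ i, ρ • e i = e (![3, 4, 5, 0, 1, 2] i)) (hce : ∀ i, c • e i = e (![1, 2, 0, 4, 5, 3] i))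
    (he' : Function.Injective e') (hsurj' : Function.Surjective e')
    (hρe' : ∀ i, ρ • e' i = e' (![1, 0, 5, 6, 7, 2, 3, 4] i)) (hce' : ∀ i, c • e' i = e' (![0, 1, 3, 4, 2, 6, 7, 5] i))
    (hPanti : P ≤ antiWeights (E := X) ρ) (hPst : ∀ g : G, ∀ f ∈ P, (fun x => f (g • x)) ∈ P)
    (hT : ∀ g : G, ∀ f ∈ P, T (fun x => f (g • x)) = fun y => T f (g • y))
    (hTanti : ∀ f ∈ P, T f ∈ antiWeights (E := Y) ρ) (hTinj : ∀ f ∈ P, T f = 0 → f = 0)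
    (h2 : 2 ≤ Module.finrank ℚ P) :
    ((Pi.single (e' 2) (1 : ℚ) - Pi.single (e' 5) 1) - (Pi.single (e' 3) (1 : ℚ) - Pi.single (e' 6) 1) : Y → ℚ) ∈
      P.map T := by
  obtain ⟨p, hpP, hp0, hs⟩ := exists_mem_trace_eq_zero e (P := P) h2
  obtain ⟨hq0, hqS⟩ := apply_eq_zero_and_sum_eq_zero_of_trace hsurj hρe hce hce' hPanti hPst T hT hpP hs
  set b₀ := T p (e' 2) with hb₀
  set b₂ := T p (e' 4) with hb₂
  have hb₁ : T p (e' 3) = -b₀ - b₂ := by linarith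
  set D : ℚ := -(b₀ ^ 2 + b₀ * b₂ + b₂ ^ 2) with hD
  have hD0 : D ≠ 0 := by
    intro hD0
    have hsq : (b₀ + b₂ / 2) ^ 2 + 3 / 4 * b₂ ^ 2 = 0 := by linear_combination -hD0
    have hb₂0 : b₂ = 0 := by nlinarith
    have hb₀0 : b₀ = 0 := by nlinarith
    apply hp0
    apply hTinj p hpP
    exact eq_zero_of_frame₈ hsurj' hρe' (hTanti p hpP) hq0 (by rw [← hb₀, hb₀0]) (by rw [hb₁, hb₀0, hb₂0]; ring)
      (by rw [← hb₂, hb₂0])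
  -- values of `q = Tp` and of `q ∘ c` on the frame
  have hvq : ∀ i, T p (e' i) = ![0, 0, b₀, -b₀ - b₂, b₂, -b₀, b₀ + b₂, -b₂] i := by
    intro i
    rw [apply_frame₈ hρe' (hTanti p hpP) i]
    fin_cases i <;> simp [hq0, hb₁] <;> ring
  have hqc : T (fun x => p (c • x)) = fun y => T p (c • y) := hT c p hpP
  -- the identity `D • (v₀ − v₁) = −b₀ • q + b₂ • (q∘c)`
  have hid : (D • ((Pi.single (e' 2) (1 : ℚ) - Pi.single (e' 5) 1) -
      (Pi.single (e' 3) (1 : ℚ) - Pi.single (e' 6) 1)) : Y → ℚ) =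
      -b₀ • T p + b₂ • T (fun x => p (c • x)) := by
    refine eq_of_forall_frame hsurj' fun i => ?_
    rw [hqc]
    simp only [Pi.smul_apply, Pi.sub_apply, Pi.add_apply, smul_eq_mul, single_frame_apply he']
    rw [hce', hvq, hvq]
    fin_cases i <;> simp [hD] <;> ring
  have hmem : (-b₀ • T p + b₂ • T (fun x => p (c • x)) : Y → ℚ) ∈ P.map T :=
    Submodule.add_mem _ (Submodule.smul_mem _ _ ⟨p, hpP, rfl⟩)
      (Submodule.smul_mem _ _ ⟨_, hPst c p hpP, rfl⟩)
  rw [← hid] at hmem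
  exact (Submodule.smul_mem_iff _ hD0).1 hmem

end Constituent

end Summit.HodgeConjecture.CorCM.SexticOctic

end
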